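import Mathlib
import Summits.NavierStokesRegularity.NavierStokesRegularity.Theorems.EulerZoomLiouvillePowerGaugeEulerLiouvilleDSSSimilarityBernoulliMember
import HarnessLib.Audit

/-!
# Crux E `PowerGaugeEulerLiouville` (stmt-NavierStokesRegularity-19832): THE SCALE-INVARIANT PRESSURE BOUNDS OF A DSS MEMBER ARE AUTOMATIC
# (pressure DSS law + continuity on one period), and the DSS sub-Bernoulli stratum with the pressure law in place of the core bounds

Route `EulerZoomLiouville` (NavierStokesRegularity), crux E, width seat ns-cas-k2 (g2), key K-A″ (DSS version, cleanup).  For a classical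
member whose pressure obeys the class DSS law `p(τ,y) = l^{2+2ρ} p(l^{2+ρ}τ, ly)` (the law forced on `∇p = −D_t u` by the velocity law, with the
free time-dependent constant fixed), the scale-invariant sizes `(−s)^{2−2n} p` and `(−s)^{2−n}‖∇p‖` (`n = 1/(2+ρ)`) are DSS-invariant, hence
bounded on every moving ball `‖x‖ ≤ R(−s)ⁿ` by their maxima over the compact fundamental piece `{t ∈ [−T,−1], ‖x‖ ≤ R(−t)ⁿ}`
(`exists_pressure_core_bounds_of_dss`).  Consequently the member theorem of `…DSSSimilarityBernoulliMember` holds with the pressure core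
bounds REPLACED by the pressure DSS law: `ae_eq_zero_of_gauge_of_dss_of_clock'` — crux hypotheses (every `ρ > 0`) + classical + velocity AND
pressure DSS laws + tame + sub-Bernoulli pressure clock + pointwise-subcritical exactly self-similar particle paths ⇒ trivial.

WHAT THIS IS NOT: not NS regularity, not the crux E, not the DSS Liouville theorem. [folklore]
-/

noncomputable section

set_option linter.dupNamespace false

open MeasureTheory Set Filter Topology Metric Function
open scoped NNReal ENNReal ContDiff InnerProductSpace RealInnerProductSpace

namespace Summit.NavierStokesRegularity.NavierStokesRegularity.Theorems.PowerGaugeEulerLiouville.SimilarityBernoulli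

open Literature.Analysis Literature.Analysis.FluidPDE Literature.Analysis.FunctionSpaces

variable {u : ℝ → EuclideanSpace ℝ (Fin 3) → EuclideanSpace ℝ (Fin 3)} {p : ℝ → EuclideanSpace ℝ (Fin 3) → ℝ} {θ ρ l : ℝ}

/-! ### Iterated pressure law and the scale-invariant pressure sizes -/

/-- **The `m`-fold pressure DSS law**: `p(τ,y) = (l^{2+2ρ})ᵐ p((l^{2+ρ})ᵐτ, lᵐy)`. [folklore] -/
theorem pressure_dss_iterate (hl : 1 < l) (hρ : 0 < 2 + ρ)
    (hp : ∀ τ : ℝ, τ < 0 → ∀ y, p τ y = l ^ (2 + 2 * ρ) * p ((l ^ (2 + ρ)) * τ) (l • y))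
    (m : ℕ) {τ : ℝ} (hτ : τ < 0) (y : EuclideanSpace ℝ (Fin 3)) :
    p τ y = (l ^ (2 + 2 * ρ)) ^ m * p ((l ^ (2 + ρ)) ^ m * τ) (l ^ m • y) := by
  induction m generalizing τ y with
  | zero => simp
  | succ m ih =>
    have hT : 1 < l ^ (2 + ρ) := Real.one_lt_rpow hl hρ
    have hτm : (l ^ (2 + ρ)) ^ m * τ < 0 := mul_neg_of_pos_of_neg (pow_pos (zero_lt_one.trans hT) m) hτ
    rw [ih hτ y, hp _ hτm (l ^ m • y), smul_smul, ← mul_assoc]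
    have e1 : (l ^ (2 + 2 * ρ)) ^ m * l ^ (2 + 2 * ρ) = (l ^ (2 + 2 * ρ)) ^ (m + 1) := (pow_succ _ _).symm
    have e2 : l ^ (2 + ρ) * ((l ^ (2 + ρ)) ^ m * τ) = (l ^ (2 + ρ)) ^ (m + 1) * τ := by ring
    have e3 : l * l ^ m = l ^ (m + 1) := by ring
    rw [e1, e2, e3]

/-- `((l^{2+ρ})ᵐ)^{2 − 2/(2+ρ)} = (l^{2+2ρ})ᵐ`. [folklore] -/
theorem rpow_period_two_sub (hl : 0 < l) (hρ : 0 < 2 + ρ) (m : ℕ) :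
    ((l ^ (2 + ρ)) ^ m) ^ (2 - 2 * (2 + ρ)⁻¹) = (l ^ (2 + 2 * ρ)) ^ m := by
  rw [← Real.rpow_natCast (l ^ (2 + ρ)) m, ← Real.rpow_mul hl.le, ← Real.rpow_mul hl.le,
    ← Real.rpow_natCast (l ^ (2 + 2 * ρ)) m, ← Real.rpow_mul hl.le]
  congr 1
  field_simp
  ring

/-- `((l^{2+ρ})ᵐ)^{2 − 1/(2+ρ)} = (l^{2+2ρ})ᵐ · lᵐ`. [folklore] -/
theorem rpow_period_two_sub_inv (hl : 0 < l) (hρ : 0 < 2 + ρ) (m : ℕ) :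
    ((l ^ (2 + ρ)) ^ m) ^ (2 - (2 + ρ)⁻¹) = (l ^ (2 + 2 * ρ)) ^ m * l ^ m := by
  rw [← Real.rpow_natCast (l ^ (2 + ρ)) m, ← Real.rpow_mul hl.le, ← Real.rpow_mul hl.le,
    ← Real.rpow_natCast (l ^ (2 + 2 * ρ)) m, ← Real.rpow_mul hl.le, ← Real.rpow_natCast l m, ← Real.rpow_add hl]
  congr 1
  field_simp
  ring

/-- **The scaled pressure is DSS-invariant**: `(−Tᵐτ)^{2−2n} p(Tᵐτ, lᵐy) = (−τ)^{2−2n} p(τ,y)`. [folklore] -/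
theorem scaledPressure_dss_iterate (hl : 1 < l) (hρ : 0 < 2 + ρ)
    (hp : ∀ τ : ℝ, τ < 0 → ∀ y, p τ y = l ^ (2 + 2 * ρ) * p ((l ^ (2 + ρ)) * τ) (l • y))
    (m : ℕ) {τ : ℝ} (hτ : τ < 0) (y : EuclideanSpace ℝ (Fin 3)) :
    (-((l ^ (2 + ρ)) ^ m * τ)) ^ (2 - 2 * (2 + ρ)⁻¹) * p ((l ^ (2 + ρ)) ^ m * τ) (l ^ m • y) =
      (-τ) ^ (2 - 2 * (2 + ρ)⁻¹) * p τ y := by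
  have hl0 : 0 < l := zero_lt_one.trans hl
  have hK : 0 < (l ^ (2 + 2 * ρ)) ^ m := pow_pos (Real.rpow_pos_of_pos hl0 _) m
  have hTm : 0 ≤ (l ^ (2 + ρ)) ^ m := pow_nonneg (Real.rpow_nonneg hl0.le _) m
  rw [pressure_dss_iterate hl hρ hp m hτ y, show -((l ^ (2 + ρ)) ^ m * τ) = (l ^ (2 + ρ)) ^ m * (-τ) by ring,
    Real.mul_rpow hTm (by linarith), rpow_period_two_sub hl0 hρ m]
  field_simp

/-- **The scaled pressure gradient is DSS-invariant**: `(−Tᵐτ)^{2−n} ‖∇p(Tᵐτ, lᵐy)‖ = (−τ)^{2−n} ‖∇p(τ,y)‖`. [folklore] -/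
theorem scaledPressureGradient_dss_iterate (hl : 1 < l) (hρ : 0 < 2 + ρ)
    (hp : ∀ τ : ℝ, τ < 0 → ∀ y, p τ y = l ^ (2 + 2 * ρ) * p ((l ^ (2 + ρ)) * τ) (l • y))
    (m : ℕ) {τ : ℝ} (hτ : τ < 0) (y : EuclideanSpace ℝ (Fin 3)) :
    (-((l ^ (2 + ρ)) ^ m * τ)) ^ (2 - (2 + ρ)⁻¹) * ‖gradient (p ((l ^ (2 + ρ)) ^ m * τ)) (l ^ m • y)‖ =
      (-τ) ^ (2 - (2 + ρ)⁻¹) * ‖gradient (p τ) y‖ := by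
  have hl0 : 0 < l := zero_lt_one.trans hl
  have hK : 0 < (l ^ (2 + 2 * ρ)) ^ m * l ^ m := mul_pos (pow_pos (Real.rpow_pos_of_pos hl0 _) m) (pow_pos hl0 m)
  have hTm : 0 ≤ (l ^ (2 + ρ)) ^ m := pow_nonneg (Real.rpow_nonneg hl0.le _) m
  have hfun : p τ = fun y => (l ^ (2 + 2 * ρ)) ^ m • p ((l ^ (2 + ρ)) ^ m * τ) (l ^ m • y) := by
    funext y; rw [smul_eq_mul]; exact pressure_dss_iterate hl hρ hp m hτ y
  have hD : fderiv ℝ (p τ) y = ((l ^ (2 + 2 * ρ)) ^ m * l ^ m) • fderiv ℝ (p ((l ^ (2 + ρ)) ^ m * τ)) (l ^ m • y) := by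
    rw [hfun, fderiv_const_smul_comp_smul_apply]
  have hg : ‖gradient (p τ) y‖ = ((l ^ (2 + 2 * ρ)) ^ m * l ^ m) * ‖gradient (p ((l ^ (2 + ρ)) ^ m * τ)) (l ^ m • y)‖ := by
    rw [gradient, gradient, LinearIsometryEquiv.norm_map, LinearIsometryEquiv.norm_map, hD, norm_smul, Real.norm_eq_abs,
      abs_of_pos hK]
  rw [hg, show -((l ^ (2 + ρ)) ^ m * τ) = (l ^ (2 + ρ)) ^ m * (-τ) by ring, Real.mul_rpow hTm (by linarith),
    rpow_period_two_sub_inv hl0 hρ m]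
  ring

/-! ### The fundamental piece is compact; the scale-invariant pressure sizes are bounded on every moving ball -/

/-- **AUTOMATIC PRESSURE CORE BOUNDS FOR A DSS MEMBER**: if `p` is jointly smooth on `(−∞,0) × ℝ³` and obeys the pressure DSS law, then
for every `R` there are `P₀, G` with `(−s)^{2−2n} p(s,x) ≤ P₀` and `(−s)^{2−n}‖∇p(s,x)‖ ≤ G` whenever `‖x‖ ≤ R(−s)ⁿ`, `s < 0`. [folklore] -/
theorem exists_pressure_core_bounds_of_dss (hsm : IsSmoothSpaceTimeOn (Iio 0) p) (hl : 1 < l) (hρ : 0 < 2 + ρ)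
    (hp : ∀ τ : ℝ, τ < 0 → ∀ y, p τ y = l ^ (2 + 2 * ρ) * p ((l ^ (2 + ρ)) * τ) (l • y)) (R : ℝ) :
    ∃ P₀ G : ℝ, ∀ s : ℝ, s < 0 → ∀ x : EuclideanSpace ℝ (Fin 3), ‖x‖ ≤ R * (-s) ^ (2 + ρ)⁻¹ →
      (-s) ^ (2 - 2 * (2 + ρ)⁻¹) * p s x ≤ P₀ ∧ (-s) ^ (2 - (2 + ρ)⁻¹) * ‖gradient (p s) x‖ ≤ G := by
  have hl0 : 0 < l := zero_lt_one.trans hl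
  set n : ℝ := (2 + ρ)⁻¹ with hn
  have hn0 : 0 ≤ n := (inv_pos.2 hρ).le
  set T : ℝ := l ^ (2 + ρ) with hT
  have hT1 : 1 < T := Real.one_lt_rpow hl hρ
  have hT0 : 0 < T := zero_lt_one.trans hT1
  -- the fundamental piece `D = {(t,x) : t ∈ [−T,−1], ‖x‖ ≤ R(−t)ⁿ}` is compact and sits in `(−∞,0) × ℝ³`
  set D : Set (ℝ × EuclideanSpace ℝ (Fin 3)) := {z | z.1 ∈ Icc (-T) (-1) ∧ ‖z.2‖ ≤ R * (-z.1) ^ n} with hD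
  have hDc : IsCompact D := by
    have hsub : D ⊆ Icc (-T) (-1) ×ˢ closedBall (0 : EuclideanSpace ℝ (Fin 3)) (|R| * T ^ n) := by
      rintro ⟨t, x⟩ ⟨ht, hx⟩
      refine ⟨ht, mem_closedBall_zero_iff.2 (hx.trans ?_)⟩
      have h1 : (-t) ^ n ≤ T ^ n := Real.rpow_le_rpow (by linarith [ht.2]) (by linarith [ht.1]) hn0
      have h2 : 0 ≤ (-t) ^ n := Real.rpow_nonneg (by linarith [ht.2]) _
      calc R * (-t) ^ n ≤ |R| * (-t) ^ n := mul_le_mul_of_nonneg_right (le_abs_self R) h2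
        _ ≤ |R| * T ^ n := mul_le_mul_of_nonneg_left h1 (abs_nonneg R)
    have hclosed : IsClosed D := by
      have hc1 : Continuous fun z : ℝ × EuclideanSpace ℝ (Fin 3) => ‖z.2‖ := continuous_norm.comp continuous_snd
      have hc2 : Continuous fun z : ℝ × EuclideanSpace ℝ (Fin 3) => R * (-z.1) ^ n :=
        continuous_const.mul ((Real.continuous_rpow_const hn0).comp (continuous_neg.comp continuous_fst))
      rw [hD, setOf_and]
      exact (isClosed_Icc.preimage continuous_fst).inter (isClosed_le hc1 hc2)
    exact ((isCompact_Icc.prod (isCompact_closedBall _ _)).of_isClosed_subset hclosed hsub)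
  have hDsub : D ⊆ Iio (0 : ℝ) ×ˢ (univ : Set (EuclideanSpace ℝ (Fin 3))) := fun z hz =>
    ⟨by have := hz.1.2; show z.1 < 0; linarith, mem_univ _⟩
  -- the two scale-invariant sizes are continuous on `(−∞,0) × ℝ³`
  have hpc : ContinuousOn (uncurry p) (Iio (0:ℝ) ×ˢ univ) := hsm.continuousOn
  have hDpc : ContinuousOn (uncurry fun t x => fderiv ℝ (p t) x) (Iio (0:ℝ) ×ˢ univ) :=
    (hsm.fderiv_slice isOpen_Iio.uniqueDiffOn).continuousOn
  have hpow : ∀ q : ℝ, ContinuousOn (fun z : ℝ × EuclideanSpace ℝ (Fin 3) => (-z.1) ^ q) (Iio (0:ℝ) ×ˢ univ) := fun q z hz =>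
    ((continuous_neg.comp continuous_fst).continuousAt.rpow_const (Or.inl (by
      have : z.1 < 0 := hz.1; simp; linarith))).continuousWithinAt
  have hQ1 : ContinuousOn (fun z : ℝ × EuclideanSpace ℝ (Fin 3) => (-z.1) ^ (2 - 2 * n) * p z.1 z.2) D :=
    ((hpow _).mul hpc).mono hDsub
  have hQ2 : ContinuousOn (fun z : ℝ × EuclideanSpace ℝ (Fin 3) => (-z.1) ^ (2 - n) * ‖gradient (p z.1) z.2‖) D := by
    refine ((hpow _).mul ?_).mono hDsub
    have e : (fun z : ℝ × EuclideanSpace ℝ (Fin 3) => ‖gradient (p z.1) z.2‖) =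
        fun z => ‖(uncurry fun t x => fderiv ℝ (p t) x) z‖ := by
      funext z; rw [gradient, LinearIsometryEquiv.norm_map]; rfl
    rw [e]; exact hDpc.norm
  obtain ⟨C₁, hC₁⟩ := hDc.exists_bound_of_continuousOn hQ1
  obtain ⟨C₂, hC₂⟩ := hDc.exists_bound_of_continuousOn hQ2
  refine ⟨C₁, C₂, fun s hs x hx => ?_⟩
  -- transfer `(s,x)` to the fundamental piece
  obtain ⟨m, t, ht, hcase⟩ := exists_fundamental_period hT1 hs
  have ht0 : t < 0 := by linarith [ht.2]
  have hlm : 0 < l ^ m := pow_pos hl0 m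
  rcases hcase with h | h
  · -- `s = T^m t`: `x = l^m z` with `(t, z) ∈ D`
    set z : EuclideanSpace ℝ (Fin 3) := (l ^ m)⁻¹ • x with hz
    have hxz : l ^ m • z = x := by rw [hz, smul_smul, mul_inv_cancel₀ hlm.ne', one_smul]
    have hzR : ‖z‖ ≤ R * (-t) ^ n := by
      rw [← norm_smul_le_iff_dss hl hρ m ht0 R z, hxz, ← hT, ← h]; exact hx
    have hmem : (t, z) ∈ D := ⟨ht, hzR⟩
    have e1 := scaledPressure_dss_iterate hl hρ hp m ht0 z
    have e2 := scaledPressureGradient_dss_iterate hl hρ hp m ht0 z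
    rw [hxz, ← hT, ← h] at e1 e2
    refine ⟨?_, ?_⟩
    · rw [e1]; exact (le_abs_self _).trans ((Real.norm_eq_abs _).symm.le.trans (hC₁ _ hmem))
    · rw [e2]; exact (le_abs_self _).trans ((Real.norm_eq_abs _).symm.le.trans (hC₂ _ hmem))
  · -- `t = T^m s`: `(t, l^m x) ∈ D`
    have hxR : ‖l ^ m • x‖ ≤ R * (-t) ^ n := by
      rw [h, hT, norm_smul_le_iff_dss hl hρ m hs R x]; exact hx
    have hmem : (t, l ^ m • x) ∈ D := ⟨ht, hxR⟩
    have e1 := scaledPressure_dss_iterate hl hρ hp m hs x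
    have e2 := scaledPressureGradient_dss_iterate hl hρ hp m hs x
    rw [← hT, ← h] at e1 e2
    refine ⟨?_, ?_⟩
    · rw [← e1]; exact (le_abs_self _).trans ((Real.norm_eq_abs _).symm.le.trans (hC₁ _ hmem))
    · rw [← e2]; exact (le_abs_self _).trans ((Real.norm_eq_abs _).symm.le.trans (hC₂ _ hmem))

/-! ### Member level: the pressure law replaces the pressure core bounds -/

/-- **TAME DSS MEMBERS (VELOCITY AND PRESSURE DSS LAWS) WITH A SUB-BERNOULLI PRESSURE CLOCK WHOSE EXACTLY SELF-SIMILAR PARTICLE PATHS ARE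
POINTWISE SUBCRITICAL ARE TRIVIAL.**  Crux hypotheses verbatim (every `ρ > 0`) + classical + `u(τ,y) = l^{1+ρ}u(l^{2+ρ}τ, ly)`,
`p(τ,y) = l^{2+2ρ}p(l^{2+ρ}τ, ly)` (`l > 1`) + tame + the pressure clock (`θ < 1`) + every permanent node pointwise subcritical
(vacuous without exactly self-similar particle paths) ⇒ `u = 0` a.e. [folklore] -/
theorem ae_eq_zero_of_gauge_of_dss_of_clock' (hρ : 0 < ρ)
    {H : ℝ → EuclideanSpace ℝ (Fin 3) → EuclideanSpace ℝ (Fin 3) →L[ℝ] EuclideanSpace ℝ (Fin 3)} {c₀ : ℝ≥0}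
    (hsw : IsSuitableWeakSolutionOn (slab (EuclideanSpace ℝ (Fin 3)) (Iio 0) isOpen_Iio) 0 0 u p)
    (hH : HasWeakSpatialGradientOn (slab (EuclideanSpace ℝ (Fin 3)) (Iio 0) isOpen_Iio) u H)
    (hgauge : ∀ a : ℝ, 0 < a →
      ENNReal.ofReal (a ^ (2 * ρ)) * cknA a (0 : ℝ × EuclideanSpace ℝ (Fin 3)) u +
          ENNReal.ofReal (a ^ ρ) * cknE a (0 : ℝ × EuclideanSpace ℝ (Fin 3)) H +
        ENNReal.ofReal (a ^ (2 * ρ)) * cknD a (0 : ℝ × EuclideanSpace ℝ (Fin 3)) p ≤ (c₀ : ℝ≥0∞))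
    (hcl : IsClassicalEulerSolutionOn (Iio 0) 0 u p) (hl : 1 < l)
    (hdss : ∀ τ : ℝ, τ < 0 → ∀ y, u τ y = (l ^ (1 + ρ)) • u ((l ^ (2 + ρ)) * τ) (l • y))
    (hpdss : ∀ τ : ℝ, τ < 0 → ∀ y, p τ y = l ^ (2 + 2 * ρ) * p ((l ^ (2 + ρ)) * τ) (l • y))
    (htame : ∀ s t : ℝ, s < t → t < 0 → ∃ B : ℝ, ∀ τ ∈ Icc s t, ∀ y : EuclideanSpace ℝ (Fin 3),
      ‖u τ y‖ ≤ B ∧ ‖fderiv ℝ (u τ) y‖ ≤ B)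
    (hθ : θ < 1)
    (hclock : ∀ s : ℝ, s < 0 → ∀ x : EuclideanSpace ℝ (Fin 3),
      (-s) * timeDerivWithin (Iio 0) p s x - (2 + ρ)⁻¹ * fderiv ℝ (p s) x x - 2 * (1 - (2 + ρ)⁻¹) * p s x ≤
        θ * (1 - 2 * (2 + ρ)⁻¹) * ‖u s x + ((2 + ρ)⁻¹ / (-s)) • x‖ ^ 2)
    (hnodes : ∀ y : EuclideanSpace ℝ (Fin 3),
      (∀ t : ℝ, t < 0 → u t ((-t) ^ (2 + ρ)⁻¹ • y) = (-((2 + ρ)⁻¹ * (-t) ^ ((2 + ρ)⁻¹ - 1))) • y) →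
      ∀ t : ℝ, t < 0 → ∀ v : EuclideanSpace ℝ (Fin 3), v ≠ 0 →
        (-t) * ⟪fderiv ℝ (u t) ((-t) ^ (2 + ρ)⁻¹ • y) v, v⟫ < ‖v‖ ^ 2) :
    uncurry u =ᵐ[volume.restrict (Iio (0 : ℝ) ×ˢ (univ : Set (EuclideanSpace ℝ (Fin 3))))] 0 :=
  ae_eq_zero_of_gauge_of_dss_of_clock_pointwise hρ hsw hH hgauge hcl hl hdss htame hθ hclock
    (fun R _ => exists_pressure_core_bounds_of_dss hcl.smooth_pressure hl (by linarith) hpdss R) hnodes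

end Summit.NavierStokesRegularity.NavierStokesRegularity.Theorems.PowerGaugeEulerLiouville.SimilarityBernoulli

end
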